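import Mathlib
import Literature.MathematicalPhysics.QuantumFieldTheory.Balaban1983to89.B11SectG
import Literature.MathematicalPhysics.QuantumFieldTheory.Balaban1983to89.B9Thm34Ext

/-!
# `Balaban1983to89.B11KernelDictionary` — T. Bałaban, *The variational problem and background fields in
renormalization group method for lattice gauge theories*, Commun. Math. Phys. **102** (1985) 277–309
[Balaban1985Variational] (= B11 of the cell's numbering; [3] = [Balaban1984PropagatorsII] = B6, [5] =
[Balaban1985BackgroundPropagators] = B9): the KERNEL DICTIONARY of Sects. C, D, G.

WHAT THIS MODULE IS.  `B11SectG` kernel-checks the chain (182)–(190) over an ABSTRACT block-normed space `bN` and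
states in prose (its header and the docstring of `B11SectG.Ineq190`) that *"with `bout` = the N-size this is the pair
of entries n = 0, 1 of `B11.pref190` (scale weights and (L^{j′}η)^{−d} inside the sizes)"*; the cell's interface row
C-IF-03 certifies informally that B11 (46) follows from [5] (3.133) by a *"scale-exchange summation … ≤ 5 lines, not
displayed"*.  This module supplies the CONCRETE CARRIERS and kernel-checks those dictionary sentences — every one of
them an "i.e." / "or" / "implies" printed in the paper between a POINTWISE KERNEL BOUND WITH SCALE PREFACTORS and a
BOUND IN THE WEIGHTED NORMS |·|_{(−n)}:

CITATION HEADER (lean-in-tree rule; quotations from the page renders of the cell, journal page = PDF page + 276):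

> (115) p. 294 [PDF 18]: *"|A₁| < ε₄(L^jη)^{−1}, |∇A₁| < ε₄(L^jη)^{−2} on Ω_j, i.e. max{|A₁|_{(−1)}, |∇A₁|_{(−2)}} < ε₄. (115)"*
> p. 295 [PDF 19]: *"By Theorem 3.13 of [5] the norm max{|·|_{(−1)}, |∇·|_{(−2)}} of the transformation can be
> estimated by …"*
> (45)–(46) p. 285 [PDF 9]: *"L^jηQ_jHB = B on Λ_j, RD\*HB = 0, (45) and the Theorem 3.12 from [5] implies
> |HB| ≦ B₀(L^jη)^{−1}|B|, |∇HB| ≦ B₀(L^jη)^{−2}|B| on Ω_j. (46)"*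
> (129)–(130) pp. 297–298 [PDF 21–22]: *"H₀B = GQ\*(QGQ\*)^{−1}(L^{j(·)}η)^{−1}B, (129) and satisfies the bound (3.133) [5]
> with the additional inequality for the covariant Laplace operator |(Δ_{U₀}H_{0,μν})(x, y′)| ≦
> B₀(L^jη)^{−3}(L^{j′}η)^{−d}e^{−δ₀d(y,y′)}, x ∈ Δ(y), y ∈ Λ_j, y′ ∈ Λ_{j′}, or |Δ_{U₀}H₀B|_{(−3)} ≦ B₀|B|. (130)"*
> (190) p. 308 [PDF 32] (quoted in full in `B11SectG.Ineq190`): *"|(δ/δB_ν(y′))𝓗_μ(B,x)|, |∇_x(δ/δB_ν(y′))𝓗_μ(B,x)|, …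
> ≤ O(1)[(L^jη)^{−1}, (L^jη)^{−2}, …](L^{j′}η)^{−d} exp(−⅛δ₀d(y,y′)) (190) for x ∈ Δ(y), … y ∈ Λ_j, y′ ∈ Λ_{j′}."*
> [5] (3.133) p. 422 [PDF 34] (quoted in full in `B9.Ineq3133`): *"|H_{μν}(x, y′)|, |∇H_{μν}(x, y′)|, … ≤ O(1)[1,
> (L^jη)^{−1}, …](L^{j′}η)^{−d}e^{−(1/2)δ₁d(y,y′)}, for x ∈ Δ(y), … y ∈ Λ_j, y′ ∈ Λ_{j′}. (3.133) … we get (3.133) with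
> an additional factor (L^jη)^{−1}, or (L^{j′}η)^{−1}, on the right-hand side."*
> [3] (2.51)–(2.52), (2.55)ₐ p. 232 (no display numbered (2.53) is printed — numbering anomaly recorded as cell
> DIVERGENCE D-pv08.1 and in the `B6RandomWalk` header note (i)) and Lemma 2.1 (2.60)–(2.61) p. 234 (typed
> `B6RandomWalk.HasMajorant`, `B6RandomWalk.Ineq260`, `B11SectG.RowSum`).  NOT quotations but READINGS used below: the
> majorant SHAPE |(Tλ)(x)| ≤ K(y, y′)|λ| for x ∈ B^j(y), supp λ ⊂ B^{j′}(y′) (schematic, `B6RandomWalk.HasMajorant`; the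
> printed (2.51) reads *"|(Rλ)(x)| ≦ O(M^{−1})e^{−δ₀d(x,y)}|λ| if supp λ ⊂ B^j(y), y ∈ Λ_j"*) and the block decomposition
> Σ_y Δ(y) = I inserted in (2.52) (a reading of *"where Δ(y) = B^j(y) if y ∈ Λ_j"*, not a printed display).  Printed and quoted:
> *"e^{−αδ₀d(y,y′)} ≤ e^{−αδ₀RM max{|j−j′|−1,0}}"*, *"sup_y Σ_{y′} e^{−αδ₀d(y,y′)} ≤ c₁(α)"*.

CONTENTS (all sorry-free; nothing here is a cited fact — every analytic input is a hypothesis of the printed shape):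
* §1 `fsup`, `weightedBlocks g blk wt` — the weighted sharp-block sizes: loc_y(f) = sup⁺_{x∈Δ(y)} wt(x)|f(x)|, a
  `B11SectG.BlockNorm` with sharp cuts (κ = 1); `loc_le_iff` IS the "i.e." of (115) (pointwise bound with prefactor
  ⟺ bound of the weighted size); `loc_smul` (absolute homogeneity).
* §2 `hasMaj_iff_columns` — a majorant out of the B-size (functions on 𝔅, singleton blocks, weight w_B) into an
  absolutely homogeneous block-normed space is EXACTLY a bound on the columns T(δ_{y′}) = (δ/δB(y′))(TB), the objects
  of (190).
* §3 `kernelOp w k` (operator with kernel k and η-scale pairing weight w), `hasMaj_kernelOp_iff` (KERNEL BOUND ⟺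
  MAJORANT, pointwise), `opBound_of_hasMaj` (majorant + row sum (2.61) ⟹ operator bound on every input: the "or" of
  (130), the passage (2.52) ⟹ (2.55)ₐ–(2.56) of [3], pp. 232–233).
* §4 `HasMaj.reweight` (moving a factor L^jη between kernel and size), `scaleInv` = the operator (L^{j(·)}η)^{−1} of (129)
  and `HasMaj.comp_scaleInv`.
* §5 `jet D`, `jetKernel`, `jetSize` / `jetNegSize` — the N-size max{|𝔄|_{(−1)}, |∇𝔄|_{(−2)}} as ONE block-normed space
  on X₀ ⊕ X₁ (`loc_jet_eq_max`: it IS the max), `jet_comp_kernelOp` (∇ passes under the kernel reading),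
  `hasMaj_jet_iff` (two kernel bounds ⟺ one majorant).
* §6 `eq184_lift`, `eq182_lift`, `bound188_jet_iff` — the equations (182), (184) and the bound (188) of Sect. G lift to
  the jet carrier along J = jet ∇ when W = ((δ²/δA′²)V)(𝒜₀ + H₀B) and 𝔇(𝒜₀ + H₀B) factor through the jet (they depend
  on 𝔄 through (𝔄, ∇𝔄), (186)/(189)), so `B11SectG.ineq190_of_189` applies VERBATIM with bN := `jetNegSize g blk₀ blk₁ 1 2`.
* §7 `LevelGap`, `levelGap_of_ineq260` ((2.60) ⟹ RM(|j−j′|−1) ≤ d(y,y′)), `len_le_exchange` (L^jη ≤ L·e^{εd(y,y′)}·L^{j′}η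
  for log L ≤ εRM), `prefactor_exchange` — the undisplayed scale exchange behind "(L^jη)^{−1}, or (L^{j′}η)^{−1}".
* §8 the verbatim instances: `hasMaj_negSize_iff_kernelBound` ((130)/(190)/(3.133) kernel line ⟺ majorant into
  |·|_{(−n)}), `ineq130_opBound` ((130) left ⟹ (130) right with B₀ ↦ B₀·c), `ineq190_jet_iff_pref190` (`B11SectG.Ineq190`
  on the jet carrier ⟺ the two printed lines n = 0, 1 of (190) with `B11.pref190` BY NAME), `hH0Shape_of_kernelBounds`
  ((3.133)-shape kernel bounds + (129) ⟹ the `hH0`/`hH`-shaped hypothesis of `B11SectG.ineq190_of_189`, constant C·L,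
  rate ρ − ε), `ineq46_of_kernelBounds` ((46) with B₀ := C·L·c — the C-IF-03 summation).
* §9 the edge to [5] BY NAME: `hasMaj_of_B9_ineq3133`, `hH0Shape_of_B9_ineq3133` — `B9.Ineq3133 d Hk C Cβ δ₁ U` over the
  transport `B9Thm34Ext.toB6` (identity on 𝔅, j, d, L, η) ⟹ the jet majorants, under REALISATION hypotheses saying that
  the schematic entries `Hk.e 0`, `Hk.e 1` (*"sup_{x∈Δ(y)}|H_{μν}(x,y′)|, sup_{x∈Δ(y)}|∇H_{μν}(x,y′)|"*) dominate a
  concrete kernel and its covariant derivative (`B9.HKernel` carries reals, not operators — cell GAPS G-IF-03).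

WHAT IS NOT CLAIMED.  (i) No lattice operator of the paper (H, H₀, Δ_{U₀}, ∇_{U}, Q, G) is constructed: the point sets
X, X₀, X₁, the block maps `blk`, the kernels `k` and the derivative `D` are PARAMETERS; the module proves the
equivalence of READINGS and the undisplayed summations, not (46), (130), (189), (190) or (3.133) themselves.
(ii) On the jet carrier the hypothesis `B11SectG.Ineq189 (jetNegSize …) b3 W̃ θ δ₀` quantifies over all localised jets,
not only holonomic ones — a typed STRENGTHENING of the printed (189) (cell DIVERGENCE D-B11-15); the paper's own
(189) is author-omitted (GAPS G-B11-G2) either way.  (iii) Constants and rates are explicit where the paper writes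
O(1)/B₀/δ₀: the right-hand B₀ of (130) is B₀·c(δ₀) here (D-B11-14); feeding [5] (3.133) (rate ½δ₁) into `hH0` (rate
"δ₀" of Sect. G) costs the scale-exchange rate ε and the constant L (D-B11-16) — the paper uses one letter δ₀ for
every rate ((73), (130), (161), (189), (190)).  (iv) The sizes are the sup-entries only (n = 0, 1 of (190), the first
two entries of (3.133)); the Hölder entries ((190) n = 2, (3.133) third entry) and the second-order entries n = 3, 4 are
not given concrete carriers here (`B11SectG.ineq190_strong_of_189` treats them abstractly).  (v) value = statement
fidelity / cross-paper interface bookkeeping, NOT summit progress: the located author-omitted inputs of B11 (G-B11-G2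
(189), G-B11-G1 *"exactly the same properties as Δ_a^{−1}"*, G-B11-G2a *"Proposition 2 and (181)"*) are untouched.

RELATION TO SIBLING MODULES (no duplication; all imported or cited, none modified).  `B11SectG` (abstract chain
(182)–(190), `BlockNorm`/`HasMaj`/`RowSum`); `B9Thm34Ext` (`toB6`); `B6RandomWalkHom` (two-space sharp sup majorants of
[3] — no weights, no η-pairing, no jets); `B9SectDSup.weightNorm` / `HasMaj.weight` / `HasMaj.transfer` and
`B9SectDL2Decay.len_pow_le_of_ineq260` (the [5] Sect. D skeleton): those RESCALE AN ABSTRACT block norm by a block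
weight W(y) and transfer the UN-mirrored ratio (L^{j′}η/L^jη)^t out of `Ineq260` (the mirrored ratio only under a
symmetry hypothesis `DistSymm` on d), whereas here the carriers are CONCRETE point-weighted sup sizes on function
spaces (with kernels, columns and jets), and the MIRRORED ratio L^jη/L^{j′}η (t = 1, the one (129) produces) is
exchanged from the level gap at (y, y′) with NO symmetry hypothesis (`len_le_exchange`; |j − j′| is symmetric even when
d is not).  Cell records: unit `b2b-balaban-b11-g6` (paper sub-cell B11, gen 6); `GAPS.md` C-B11-G6a (dictionary),
C-B11-G6b (C-IF-03 edge kernel-checked), `DIVERGENCE.md` D-B11-14, D-B11-15, D-B11-16.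

REVISION v1.2 (unit `b2b-balaban-b11-g7`, docstring-only, every declaration byte-identical; answers the cross-read
certificate of unit `b2b-balaban-pv03-g7`, cell GAPS C-pv03-16 / G-pv03-10): (X1) the three locators formerly reading
"(2.51)–(2.53)" / "(2.52)–(2.53)" of [3] now read (2.51)–(2.52), (2.55)ₐ p. 232 — [3] prints no display numbered (2.53)
(p. 232 carries (2.48)–(2.52) and then (2.55); numbering anomaly DIVERGENCE D-pv08.1; render of p. 232 re-read as an
image by this unit); (X2) three schematic phrases (the majorant shape, the block decomposition Σ_y Δ(y) = I, the kernel
reading of H₀) are no longer typeset as quotations — they are READINGS, and the printed (2.51)/(2.52) wordings they read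
are now quoted verbatim instead; (A1) the closing quotation mark of the (129) sentence no longer encloses the display
label (130).  Glyph policy (A2, cosmetic) unchanged: quotations keep the printed "≦" where the render was transcribed
glyph for glyph ((46), (115), (130), (2.51)) and "≤" elsewhere.
-/

namespace Literature.MathematicalPhysics.QuantumFieldTheory.Balaban1983to89.B11KernelDictionary

open Literature.MathematicalPhysics.QuantumFieldTheory.Balaban1983to89
open Finset B6RandomWalk B11SectG

/-! ## §1. Finite suprema with floor 0 and the weighted sharp-block sizes |·|_{(−n)} of (115) -/

/-- sup⁺ of a finite family of reals: max{0, max_x v(x)} (= 0 on an empty index type) — the *"sup_{x∈Δ(y)}"* of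
(130), (189), (190) and of [3] (2.51), taken with the floor 0 so that it is a total function. [folklore] -/
noncomputable def fsup {X : Type} [Fintype X] (v : X → ℝ) : ℝ :=
  ((Finset.univ : Finset X).sup fun x => (v x).toNNReal : NNReal)

/-- sup⁺ ≥ 0. [folklore] -/
theorem fsup_nonneg {X : Type} [Fintype X] (v : X → ℝ) : 0 ≤ fsup v := NNReal.coe_nonneg _

/-- Every member is below the sup⁺. [folklore] -/
theorem le_fsup {X : Type} [Fintype X] (v : X → ℝ) (x : X) : v x ≤ fsup v := by
  unfold fsup
  have h : (v x).toNNReal ≤ (Finset.univ : Finset X).sup fun x => (v x).toNNReal :=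
    Finset.le_sup (f := fun x => (v x).toNNReal) (Finset.mem_univ x)
  exact (Real.le_coe_toNNReal (v x)).trans (NNReal.coe_le_coe.mpr h)

/-- The sup⁺ is below every non-negative common bound. [folklore] -/
theorem fsup_le {X : Type} [Fintype X] {v : X → ℝ} {c : ℝ} (hc : 0 ≤ c) (h : ∀ x, v x ≤ c) : fsup v ≤ c := by
  unfold fsup
  have hs : ((Finset.univ : Finset X).sup fun x => (v x).toNNReal) ≤ c.toNNReal :=
    Finset.sup_le fun x _ => Real.toNNReal_le_toNNReal (h x)
  calc (((Finset.univ : Finset X).sup fun x => (v x).toNNReal : NNReal) : ℝ) ≤ (c.toNNReal : ℝ) :=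
        NNReal.coe_le_coe.mpr hs
    _ = c := Real.coe_toNNReal c hc

/-- A family of non-positive reals has sup⁺ = 0. [folklore] -/
theorem fsup_eq_zero_of_le {X : Type} [Fintype X] {v : X → ℝ} (h : ∀ x, v x ≤ 0) : fsup v = 0 :=
  le_antisymm (fsup_le le_rfl h) (fsup_nonneg v)

/-- Monotonicity of sup⁺. [folklore] -/
theorem fsup_mono {X : Type} [Fintype X] {v v' : X → ℝ} (h : ∀ x, v x ≤ v' x) : fsup v ≤ fsup v' :=
  fsup_le (fsup_nonneg v') fun x => (h x).trans (le_fsup v' x)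

variable {g : B6.Geometry}

/-- Δ(y)(Δ(y)ν) = Δ(y)ν. [folklore] -/
theorem blockPiece_idem {X : Type} (blk : X → g.Site) (y : g.Site) (ν : X → ℝ) :
    blockPiece blk y (blockPiece blk y ν) = blockPiece blk y ν := by
  funext x; by_cases hx : blk x = y <;> simp [blockPiece, hx]

/-- **The weighted sharp-block sizes** — (115) p. 294 [PDF 18], verbatim: *"|A₁| < ε₄(L^jη)^{−1}, |∇A₁| < ε₄(L^jη)^{−2}
on Ω_j, i.e. max{|A₁|_{(−1)}, |∇A₁|_{(−2)}} < ε₄. (115)"*; p. 295 [PDF 19]: *"the norm max{|·|_{(−1)}, |∇·|_{(−2)}}"*;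
(130) p. 298: *"|Δ_{U₀}H₀B|_{(−3)}"*.  For lattice functions f on a finite set `X` of points (bonds / plaquettes /
derivative points, possibly of several sorts) fibred over 𝔅 = `g.Site` by `blk` (x ∈ Δ(y) ⟺ blk x = y) and a
point weight `wt ≥ 0` (the printed choice: wt(x) = (L^jη)ⁿ for x ∈ Ω_j, so that "|f| < c(L^jη)^{−n} on Ω_j ∀ j"
⟺ "sup_x wt(x)|f(x)| < c"): `loc y f` = sup⁺_{x∈Δ(y)} wt(x)|f(x)| (the block-localised |f|_{(−n)}), `cut y` = Δ(y)·
(sharp restriction; the block decomposition Σ_y Δ(y) = I inserted in (2.52) [3] p. 232 — a reading, not a printed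
display), `IsLoc y′ μ` = "μ vanishes off Δ(y′)" (the support condition supp λ ⊂ B^j(y) of (2.51)), κ = 1.
A `B11SectG.BlockNorm`, so the whole majorant calculus of Sect. G applies to it.
[cite: Balaban1985Variational, (115) p.294 + p.295 + (130) p.298; Balaban1984PropagatorsII, (2.51)–(2.52) p.232] -/
noncomputable def weightedBlocks (g : B6.Geometry) {X : Type} [Fintype X] (blk : X → g.Site) (wt : X → ℝ)
    (hwt : ∀ x, 0 ≤ wt x) : BlockNorm g (X → ℝ) := by
  classical
  exact
    { loc := fun y f => fsup fun x => wt x * |blockPiece blk y f x|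
      cut := fun y =>
        { toFun := blockPiece blk y
          map_add' := fun f f' => by
            funext x; by_cases hx : blk x = y <;> simp [blockPiece, hx]
          map_smul' := fun c f => by
            funext x; by_cases hx : blk x = y <;> simp [blockPiece, hx] }
      IsLoc := fun y μ => ∀ x, blk x ≠ y → μ x = 0
      κ := 1
      κ_nonneg := zero_le_one
      loc_nonneg := fun y f => fsup_nonneg _
      loc_zero := fun y => fsup_eq_zero_of_le fun x => by
        by_cases hx : blk x = y <;> simp [blockPiece, hx]
      loc_add_le := fun y f f' => by
        refine fsup_le (add_nonneg (fsup_nonneg _) (fsup_nonneg _)) fun x => ?_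
        have h1 := le_fsup (fun x => wt x * |blockPiece blk y f x|) x
        have h2 := le_fsup (fun x => wt x * |blockPiece blk y f' x|) x
        by_cases hx : blk x = y
        · simp only [blockPiece, hx, if_true, Pi.add_apply] at h1 h2 ⊢
          calc wt x * |f x + f' x| ≤ wt x * (|f x| + |f' x|) :=
                mul_le_mul_of_nonneg_left (abs_add_le _ _) (hwt x)
            _ = wt x * |f x| + wt x * |f' x| := mul_add _ _ _
            _ ≤ _ := add_le_add h1 h2
        · simp only [blockPiece, hx, if_false, abs_zero, mul_zero]
          exact add_nonneg (fsup_nonneg _) (fsup_nonneg _)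
      loc_neg := fun y f => by
        congr 1; funext x; by_cases hx : blk x = y <;> simp [blockPiece, hx]
      sum_cut := fun f => sum_blockPiece blk f
      isLoc_cut := fun y f x hx => by simp [blockPiece, hx]
      loc_cut_le := fun y f => by
        show (fsup fun x => wt x * |blockPiece blk y (blockPiece blk y f) x|) ≤
          1 * fsup fun x => wt x * |blockPiece blk y f x|
        rw [one_mul, blockPiece_idem] }

section API

variable {X : Type} [Fintype X] {blk : X → g.Site} {wt : X → ℝ} {hwt : ∀ x, 0 ≤ wt x}

/-- Unfolding: loc y f = sup⁺_x wt(x)|(Δ(y)f)(x)|. [folklore] -/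
theorem loc_def (y : g.Site) (f : X → ℝ) :
    (weightedBlocks g blk wt hwt).loc y f = fsup fun x => wt x * |blockPiece blk y f x| := rfl

/-- Unfolding: μ is localised near y′ iff it vanishes off Δ(y′). [folklore] -/
theorem isLoc_iff (y' : g.Site) (μ : X → ℝ) :
    (weightedBlocks g blk wt hwt).IsLoc y' μ ↔ ∀ x, blk x ≠ y' → μ x = 0 := Iff.rfl

/-- Unfolding: the cut is Δ(y). [folklore] -/
theorem cut_apply (y : g.Site) (f : X → ℝ) : (weightedBlocks g blk wt hwt).cut y f = blockPiece blk y f := rfl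

/-- Unfolding: κ = 1 (sharp blocks cost nothing). [folklore] -/
theorem kappa_eq : (weightedBlocks g blk wt hwt).κ = 1 := rfl

/-- "|f(x)| ≤ …" ⟹ reading, pointwise-to-size: wt(x)|f(x)| ≤ loc_y(f) for x ∈ Δ(y). [folklore] -/
theorem le_loc {y : g.Site} (f : X → ℝ) {x : X} (hx : blk x = y) :
    wt x * |f x| ≤ (weightedBlocks g blk wt hwt).loc y f := by
  rw [loc_def]
  simpa [blockPiece, hx] using le_fsup (fun x => wt x * |blockPiece blk y f x|) x

/-- Size-to-pointwise: loc_y(f) ≤ c as soon as wt(x)|f(x)| ≤ c on Δ(y) (c ≥ 0). [folklore] -/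
theorem loc_le {y : g.Site} {f : X → ℝ} {c : ℝ} (hc : 0 ≤ c) (h : ∀ x, blk x = y → wt x * |f x| ≤ c) :
    (weightedBlocks g blk wt hwt).loc y f ≤ c := by
  refine fsup_le hc fun x => ?_
  by_cases hx : blk x = y
  · simpa [blockPiece, hx] using h x hx
  · simpa [blockPiece, hx] using hc

/-- **(115) "i.e."**, kernel-checked: for c ≥ 0, "wt(x)|f(x)| ≤ c for all x ∈ Δ(y)" ⟺ "loc_y(f) ≤ c"; with wt =
(L^jη)ⁿ on Ω_j and all y this is *"|f| ≤ c(L^jη)^{−n} on Ω_j (all j), i.e. |f|_{(−n)} ≤ c"*.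
[cite: Balaban1985Variational, (115) p.294] -/
theorem loc_le_iff {y : g.Site} {f : X → ℝ} {c : ℝ} (hc : 0 ≤ c) :
    (weightedBlocks g blk wt hwt).loc y f ≤ c ↔ ∀ x, blk x = y → wt x * |f x| ≤ c :=
  ⟨fun h _ hx => (le_loc f hx).trans h, loc_le hc⟩

/-- The sizes are absolutely homogeneous: loc_y(c·f) = |c|·loc_y(f). [folklore] -/
theorem loc_smul (y : g.Site) (c : ℝ) (f : X → ℝ) :
    (weightedBlocks g blk wt hwt).loc y (c • f) = |c| * (weightedBlocks g blk wt hwt).loc y f := by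
  refine le_antisymm ?_ ?_
  · refine loc_le (mul_nonneg (abs_nonneg c) ((weightedBlocks g blk wt hwt).loc_nonneg y f)) fun x hx => ?_
    calc wt x * |(c • f) x| = |c| * (wt x * |f x|) := by rw [Pi.smul_apply, smul_eq_mul, abs_mul]; ring
      _ ≤ |c| * (weightedBlocks g blk wt hwt).loc y f := mul_le_mul_of_nonneg_left (le_loc f hx) (abs_nonneg c)
  · by_cases hc : c = 0
    · subst hc
      simp only [abs_zero, zero_mul]
      exact (weightedBlocks g blk wt hwt).loc_nonneg y _
    · have hcpos : 0 < |c| := abs_pos.mpr hc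
      rw [← le_div_iff₀' hcpos]
      refine loc_le (div_nonneg ((weightedBlocks g blk wt hwt).loc_nonneg y _) hcpos.le) fun x hx => ?_
      rw [le_div_iff₀' hcpos]
      calc |c| * (wt x * |f x|) = wt x * |(c • f) x| := by rw [Pi.smul_apply, smul_eq_mul, abs_mul]; ring
        _ ≤ _ := le_loc (c • f) hx

end API

/-! ## §2. The B-size on 𝔅 and the COLUMN reading of a majorant ("(δ/δB_ν(y′))𝓗") -/

section Columns

variable {wB : g.Site → ℝ} {hwB : ∀ y, 0 ≤ wB y}

/-- For functions on 𝔅 itself with the singleton blocks (blk = id): loc_{y′}(μ) = w_B(y′)|μ(y′)|. [folklore] -/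
theorem loc_id (y' : g.Site) (μ : g.Site → ℝ) : (weightedBlocks g id wB hwB).loc y' μ = wB y' * |μ y'| :=
  le_antisymm (loc_le (mul_nonneg (hwB y') (abs_nonneg _)) fun x hx => by cases hx; exact le_rfl)
    (le_loc μ rfl)

open Classical in
/-- A function on 𝔅 localised at y′ (singleton blocks) is the multiple μ(y′)·δ_{y′}. [folklore] -/
theorem eq_single_of_isLoc {y' : g.Site} {μ : g.Site → ℝ} (hμ : (weightedBlocks g id wB hwB).IsLoc y' μ) :
    μ = μ y' • Pi.single y' (1 : ℝ) := by
  funext x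
  by_cases hx : x = y'
  · subst hx; simp
  · rw [Pi.smul_apply, Pi.single_eq_of_ne hx, smul_zero]
    exact hμ x hx

open Classical in
/-- δ_{y′} is localised at y′. [folklore] -/
theorem isLoc_single (y' : g.Site) (c : ℝ) : (weightedBlocks g id wB hwB).IsLoc y' (Pi.single y' c) :=
  fun x hx => by
    have hx' : x ≠ y' := hx
    simp [hx']

open Classical in
/-- **Majorant = column bounds.**  For a linear T from the functions on 𝔅 (B-size: singleton blocks, weight w_B ≥ 0)
into an ABSOLUTELY HOMOGENEOUS block-normed space: T has the majorant K iff every COLUMN T(δ_{y′}) — the functional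
derivative (δ/δB(y′)) of B ↦ TB, the object whose kernel (190) bounds — satisfies loc_y(Tδ_{y′}) ≤ K(y, y′)·w_B(y′)
(a localised μ on 𝔅 is μ(y′)δ_{y′}). [cite: Balaban1985Variational, (190) p.308; Balaban1984PropagatorsII, (2.51) p.232] -/
theorem hasMaj_iff_columns {F : Type} [AddCommGroup F] [Module ℝ F] (bN : BlockNorm g F)
    (habs : ∀ (y : g.Site) (c : ℝ) (f : F), bN.loc y (c • f) = |c| * bN.loc y f)
    (T : (g.Site → ℝ) →ₗ[ℝ] F) (K : g.Site → g.Site → ℝ) :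
    HasMaj (weightedBlocks g id wB hwB) bN T K ↔ ∀ y y' : g.Site, bN.loc y (T (Pi.single y' 1)) ≤ K y y' * wB y' := by
  constructor
  · intro h y y'
    have := h y' (Pi.single y' 1) (isLoc_single y' 1) y
    simpa [loc_id] using this
  · intro h y' μ hμ y
    have hμeq := eq_single_of_isLoc hμ
    have hT : T μ = μ y' • T (Pi.single y' 1) := by
      conv_lhs => rw [hμeq]
      rw [map_smul]
    rw [hT, habs, loc_id]
    calc |μ y'| * bN.loc y (T (Pi.single y' 1)) ≤ |μ y'| * (K y y' * wB y') :=
          mul_le_mul_of_nonneg_left (h y y') (abs_nonneg _)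
      _ = K y y' * (wB y' * |μ y'|) := by ring

end Columns

/-! ## §3. Kernel operators with the η-scale pairing and the dictionary KERNEL BOUND ⟺ MAJORANT -/

/-- The linear operator with KERNEL k(x, y′) and pairing weight w(y′) on 𝔅: (T B)(x) = Σ_{y′∈𝔅} w(y′)k(x, y′)B(y′) —
the kernel reading (H₀B)_μ(x) = Σ_{y′,ν} H_{0,μν}(x, y′)B_ν(y′) implicit in the notation H_{0,μν}(x, y′) of (130) p. 298
(no such sum is displayed on pp. 297–298; this is a reading) of an operator through its kernel, with w(y′) =
(L^{j′}η)^d the η-scale volume of the big-lattice site y′ (the origin of the factor (L^{j′}η)^{−d} in (130), (190),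
[5] (3.133)); w = 1 gives the plain matrix action. [cite: Balaban1985Variational, (130) p.298 + (190) p.308] -/
noncomputable def kernelOp {X : Type} (w : g.Site → ℝ) (k : X → g.Site → ℝ) : (g.Site → ℝ) →ₗ[ℝ] (X → ℝ) where
  toFun B := fun x => ∑ y' : g.Site, w y' * k x y' * B y'
  map_add' B B' := by
    funext x
    simp only [Pi.add_apply, mul_add, Finset.sum_add_distrib]
  map_smul' c B := by
    funext x
    simp only [Pi.smul_apply, smul_eq_mul, RingHom.id_apply, Finset.mul_sum]
    exact Finset.sum_congr rfl fun _ _ => by ring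

/-- Unfolding: (TB)(x) = Σ_{y′} w(y′)k(x, y′)B(y′). [folklore] -/
theorem kernelOp_apply {X : Type} (w : g.Site → ℝ) (k : X → g.Site → ℝ) (B : g.Site → ℝ) (x : X) :
    kernelOp w k B x = ∑ y' : g.Site, w y' * k x y' * B y' := rfl

open Classical in
/-- The column of a kernel operator at y′ is w(y′)k(·, y′). [folklore] -/
theorem kernelOp_single {X : Type} (w : g.Site → ℝ) (k : X → g.Site → ℝ) (y' : g.Site) (c : ℝ) :
    kernelOp w k (Pi.single y' c) = fun x => w y' * k x y' * c := by
  funext x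
  rw [kernelOp_apply, Finset.sum_eq_single y']
  · simp
  · intro b _ hb; simp [Pi.single_eq_of_ne hb]
  · intro h; exact (h (Finset.mem_univ _)).elim

/-- **KERNEL BOUND ⟺ MAJORANT** (the content of the word *"or"* in (130) at the level of one column, and of the
shape of (189), (190), [5] (3.133), [3] (2.51)): the kernel operator with kernel k and pairing weight w ≥ 0, from the
B-size with weight w_B ≥ 0 into the weighted sharp-block size with weight wt, has the majorant K ≥ 0 iff
wt(x)·w(y′)·|k(x, y′)| ≤ K(y, y′)·w_B(y′) for all x ∈ Δ(y), y′ ∈ 𝔅.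
[cite: Balaban1985Variational, (130) p.298; Balaban1984PropagatorsII, (2.51) p.232] -/
theorem hasMaj_kernelOp_iff {X : Type} [Fintype X] (blk : X → g.Site) (wt : X → ℝ) (hwt : ∀ x, 0 ≤ wt x)
    (wB : g.Site → ℝ) (hwB : ∀ y, 0 ≤ wB y) (w : g.Site → ℝ) (hw : ∀ y, 0 ≤ w y) (k : X → g.Site → ℝ)
    (K : g.Site → g.Site → ℝ) (hK : ∀ y y', 0 ≤ K y y') :
    HasMaj (weightedBlocks g id wB hwB) (weightedBlocks g blk wt hwt) (kernelOp w k) K ↔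
      ∀ (x : X) (y' : g.Site), wt x * (w y' * |k x y'|) ≤ K (blk x) y' * wB y' := by
  classical
  rw [hasMaj_iff_columns (weightedBlocks g blk wt hwt) (loc_smul) (kernelOp w k) K]
  constructor
  · intro h x y'
    have hcol := h (blk x) y'
    rw [kernelOp_single] at hcol
    have hx := le_loc (hwt := hwt) (blk := blk) (y := blk x) (fun x => w y' * k x y' * 1) (x := x) rfl
    simp only [mul_one, abs_mul, abs_of_nonneg (hw y')] at hx hcol
    exact hx.trans hcol
  · intro h y y'
    refine loc_le (mul_nonneg (hK y y') (hwB y')) fun x hx => ?_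
    rw [kernelOp_single]
    simp only [mul_one, abs_mul, abs_of_nonneg (hw y')]
    subst hx
    exact h x y'

/-- **(130), the word "or"** — kernel form ⟹ operator-norm form, kernel-checked: if T has the majorant C·e^{−σd(y,y′)}
from the B-size (weight w_B) into any block-normed space and the row sum (2.61) of Lemma 2.1 [3] holds at the rate σ
with constant c, then loc_y(TB) ≤ C·c·sup⁺_{y′} w_B(y′)|B(y′)| for EVERY B — with wt = (L^jη)³, w_B = 1 this is
*"|(Δ_{U₀}H_{0,μν})(x, y′)| ≦ B₀(L^jη)^{−3}(L^{j′}η)^{−d}e^{−δ₀d(y,y′)} … or |Δ_{U₀}H₀B|_{(−3)} ≦ B₀|B|"* with the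
printed right-hand B₀ READ AS B₀·c(δ₀) (the row-sum constant absorbed into O(1); cell DIVERGENCE D-B11-14).  The
converse (operator bound ⟹ kernel decay) is false in general and is not claimed by the paper.
[cite: Balaban1985Variational, (130) p.298; Balaban1984PropagatorsII, (2.52), (2.55) p.232 + (2.61) p.234] -/
theorem opBound_of_hasMaj {F : Type} [AddCommGroup F] [Module ℝ F] (bN : BlockNorm g F)
    (T : (g.Site → ℝ) →ₗ[ℝ] F) {wB : g.Site → ℝ} {hwB : ∀ y, 0 ≤ wB y} {C σ c : ℝ} (hC : 0 ≤ C)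
    (h : HasMaj (weightedBlocks g id wB hwB) bN T (fun y y' => C * Real.exp (-(σ * g.dist y y'))))
    (hrow : RowSum g σ c) (B : g.Site → ℝ) (y : g.Site) :
    bN.loc y (T B) ≤ C * c * fsup (fun y' => wB y' * |B y'|) := by
  have hK : ∀ a b, 0 ≤ C * Real.exp (-(σ * g.dist a b)) := fun a b => mul_nonneg hC (Real.exp_nonneg _)
  have hb := h.bound hK B y
  set M := fsup (fun y' => wB y' * |B y'|) with hM
  have hM0 : 0 ≤ M := fsup_nonneg _
  have hterm : ∀ y', C * Real.exp (-(σ * g.dist y y')) * ((weightedBlocks g id wB hwB).κ *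
      (weightedBlocks g id wB hwB).loc y' B) ≤ C * M * Real.exp (-(σ * g.dist y y')) := by
    intro y'
    rw [kappa_eq, one_mul, loc_id]
    have : wB y' * |B y'| ≤ M := le_fsup (fun y' => wB y' * |B y'|) y'
    calc C * Real.exp (-(σ * g.dist y y')) * (wB y' * |B y'|)
        ≤ C * Real.exp (-(σ * g.dist y y')) * M := mul_le_mul_of_nonneg_left this (hK y y')
      _ = C * M * Real.exp (-(σ * g.dist y y')) := by ring
  calc bN.loc y (T B) ≤ _ := hb
    _ ≤ ∑ y' : g.Site, C * M * Real.exp (-(σ * g.dist y y')) := Finset.sum_le_sum fun y' _ => hterm y'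
    _ = C * M * ∑ y' : g.Site, Real.exp (-(σ * g.dist y y')) := by rw [Finset.mul_sum]
    _ ≤ C * M * c := mul_le_mul_of_nonneg_left (hrow y) (mul_nonneg hC hM0)
    _ = C * c * M := by ring

/-! ## §4. Re-weighting and the scaling operator (L^{j(·)}η)^{−1} of (129) -/

section Reweight

variable {F₁ : Type} [AddCommGroup F₁] [Module ℝ F₁]
variable {X : Type} [Fintype X] {blk : X → g.Site}

/-- A majorant into a weighted size survives replacing the weight wt by any wt′ ≤ c(j(x))·wt, at the price of the
factor c(y) in the kernel — e.g. wt = (L^jη)ⁿ ↦ wt′ = (L^jη)ⁿ⁺¹ costs the factor L^jη = `g.len y` (this is how the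
*"additional factor (L^jη)^{−1}"* of [5] p. 422 moves between the kernel and the size). [folklore] -/
theorem HasMaj.reweight {b₁ : BlockNorm g F₁} {wt wt' : X → ℝ} {hwt : ∀ x, 0 ≤ wt x} {hwt' : ∀ x, 0 ≤ wt' x}
    {T : F₁ →ₗ[ℝ] (X → ℝ)} {K : g.Site → g.Site → ℝ} (c : g.Site → ℝ) (hc : ∀ y, 0 ≤ c y)
    (hw : ∀ x, wt' x ≤ c (blk x) * wt x) (h : HasMaj b₁ (weightedBlocks g blk wt hwt) T K) :
    HasMaj b₁ (weightedBlocks g blk wt' hwt') T (fun y y' => c y * K y y') := by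
  intro y' μ hμ y
  have hle : (weightedBlocks g blk wt' hwt').loc y (T μ) ≤ c y * (weightedBlocks g blk wt hwt).loc y (T μ) := by
    refine loc_le (mul_nonneg (hc y) ((weightedBlocks g blk wt hwt).loc_nonneg y _)) fun x hx => ?_
    calc wt' x * |T μ x| ≤ c (blk x) * wt x * |T μ x| := mul_le_mul_of_nonneg_right (hw x) (abs_nonneg _)
      _ = c y * (wt x * |T μ x|) := by rw [hx]; ring
      _ ≤ c y * (weightedBlocks g blk wt hwt).loc y (T μ) := mul_le_mul_of_nonneg_left (le_loc (T μ) hx) (hc y)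
  calc (weightedBlocks g blk wt' hwt').loc y (T μ) ≤ c y * (weightedBlocks g blk wt hwt).loc y (T μ) := hle
    _ ≤ c y * (K y y' * b₁.loc y' μ) := mul_le_mul_of_nonneg_left (h y' μ hμ y) (hc y)
    _ = c y * K y y' * b₁.loc y' μ := by ring

end Reweight

/-- **(129)**, the scaling factor: the operator (L^{j(·)}η)^{−1} on functions on 𝔅, B ↦ ((L^{j′}η)^{−1}B(y′))_{y′} —
(129) p. 297 [PDF 21], verbatim: *"H₀B = GQ*(QGQ*)^{−1}(L^{j(·)}η)^{−1}B, (129) and satisfies the bound (3.133) [5]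
with the additional inequality for the covariant Laplace operator"* [then the display (130) p. 298]; so H₀ = H_{[5] (3.126)} ∘
(L^{j(·)}η)^{−1}.
[cite: Balaban1985Variational, (129) p.297] -/
noncomputable def scaleInv (g : B6.Geometry) : (g.Site → ℝ) →ₗ[ℝ] (g.Site → ℝ) where
  toFun B := fun y' => (g.len y')⁻¹ * B y'
  map_add' B B' := by funext y'; simp only [Pi.add_apply, mul_add]
  map_smul' c B := by funext y'; simp only [Pi.smul_apply, smul_eq_mul, RingHom.id_apply]; ring

/-- Unfolding: ((L^{j(·)}η)^{−1}B)(y′) = (L^{j′}η)^{−1}B(y′). [cite: Balaban1985Variational, (129) p.297] -/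
theorem scaleInv_apply (B : g.Site → ℝ) (y' : g.Site) : scaleInv g B y' = (g.len y')⁻¹ * B y' := rfl

/-- Composing with (L^{j(·)}η)^{−1} on the right multiplies a majorant out of the B-size by (L^{j′}η)^{−1} — the
*"(L^{j′}η)^{−1} … on the right-hand side"* alternative of [5] p. 422 realised by (129) (L^{j′}η ≥ 0).
[cite: Balaban1985Variational, (129) p.297; Balaban1985BackgroundPropagators, (3.133) p.422] -/
theorem HasMaj.comp_scaleInv {F : Type} [AddCommGroup F] [Module ℝ F] {bN : BlockNorm g F}
    {T : (g.Site → ℝ) →ₗ[ℝ] F} {K : g.Site → g.Site → ℝ} {wB : g.Site → ℝ} {hwB : ∀ y, 0 ≤ wB y}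
    (hlen : ∀ y, 0 ≤ g.len y) (h : HasMaj (weightedBlocks g id wB hwB) bN T K) :
    HasMaj (weightedBlocks g id wB hwB) bN (T ∘ₗ scaleInv g) (fun y y' => K y y' * (g.len y')⁻¹) := by
  intro y' μ hμ y
  have hSμ : (weightedBlocks g id wB hwB).IsLoc y' (scaleInv g μ) := fun x hx => by
    rw [scaleInv_apply, hμ x hx, mul_zero]
  have h1 := h y' (scaleInv g μ) hSμ y
  rw [LinearMap.comp_apply]
  refine h1.trans (le_of_eq ?_)
  rw [loc_id, loc_id, scaleInv_apply, abs_mul, abs_of_nonneg (inv_nonneg.mpr (hlen y'))]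
  ring

/-! ## §5. The jet carrier: the N-size max{|𝔄|_{(−1)}, |∇𝔄|_{(−2)}} as ONE block-normed space -/

section Jet

variable {X₀ X₁ : Type}

/-- The 1-jet of a lattice function: f ↦ (f, ∇f) on X₀ ⊕ X₁ (X₀ = the points of f, X₁ = the points of the
covariant derivative ∇ = ∇_{U}, `D` = ∇ as a linear map) — the device by which the printed N-size
*"max{|𝔄|_{(−1)}, |∇𝔄|_{(−2)}}"* (p. 295, (115), (185)–(190)) becomes one `BlockNorm` on one function space, so that
the abstract chain `B11SectG.ineq190_of_189` (stated for a single block-normed space `bN`) reads on it literally.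
[cite: Balaban1985Variational, (115) p.294 + p.295 + (189)–(190) p.308] -/
def jet (D : (X₀ → ℝ) →ₗ[ℝ] (X₁ → ℝ)) : (X₀ → ℝ) →ₗ[ℝ] (X₀ ⊕ X₁ → ℝ) where
  toFun f := Sum.elim f (D f)
  map_add' f f' := by funext x; cases x <;> simp
  map_smul' c f := by funext x; cases x <;> simp

/-- First component of the jet: the function itself. [folklore] -/
theorem jet_apply_inl (D : (X₀ → ℝ) →ₗ[ℝ] (X₁ → ℝ)) (f : X₀ → ℝ) (x₀ : X₀) : jet D f (Sum.inl x₀) = f x₀ := rfl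

/-- Second component of the jet: the covariant derivative. [folklore] -/
theorem jet_apply_inr (D : (X₀ → ℝ) →ₗ[ℝ] (X₁ → ℝ)) (f : X₀ → ℝ) (x₁ : X₁) : jet D f (Sum.inr x₁) = D f x₁ :=
  rfl

/-- The jet determines the function (first component). [folklore] -/
theorem jet_injective (D : (X₀ → ℝ) →ₗ[ℝ] (X₁ → ℝ)) : Function.Injective (jet D) := fun f f' h => by
  funext x₀; exact congrFun h (Sum.inl x₀)

/-- The jet of a kernel: k̂(x₀, y′) = k(x₀, y′) on X₀ and k̂(x₁, y′) = (∇k(·, y′))(x₁) on X₁ — the pair of kernels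
(δ/δB_ν(y′))𝓗_μ(B, x), ∇_x(δ/δB_ν(y′))𝓗_μ(B, x) bounded by the entries n = 0, 1 of (190).
[cite: Balaban1985Variational, (190) p.308] -/
def jetKernel (D : (X₀ → ℝ) →ₗ[ℝ] (X₁ → ℝ)) (k : X₀ → g.Site → ℝ) : X₀ ⊕ X₁ → g.Site → ℝ :=
  fun x y' => Sum.elim (fun x₀ => k x₀ y') (D fun x₀ => k x₀ y') x

/-- Unfolding: k̂(x₀, y′) = k(x₀, y′). [folklore] -/
theorem jetKernel_inl (D : (X₀ → ℝ) →ₗ[ℝ] (X₁ → ℝ)) (k : X₀ → g.Site → ℝ) (x₀ : X₀) (y' : g.Site) :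
    jetKernel D k (Sum.inl x₀) y' = k x₀ y' := rfl

/-- Unfolding: k̂(x₁, y′) = (∇k(·, y′))(x₁). [folklore] -/
theorem jetKernel_inr (D : (X₀ → ℝ) →ₗ[ℝ] (X₁ → ℝ)) (k : X₀ → g.Site → ℝ) (x₁ : X₁) (y' : g.Site) :
    jetKernel D k (Sum.inr x₁) y' = D (fun x₀ => k x₀ y') x₁ := rfl

/-- Taking jets commutes with the kernel reading: jet ∘ (operator with kernel k) = operator with kernel k̂ — ∇ passes
under the finite sum over y′ by linearity. [folklore] -/
theorem jet_comp_kernelOp (D : (X₀ → ℝ) →ₗ[ℝ] (X₁ → ℝ)) (w : g.Site → ℝ) (k : X₀ → g.Site → ℝ) :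
    jet D ∘ₗ kernelOp w k = kernelOp w (jetKernel D k) := by
  apply LinearMap.ext
  intro B
  funext x
  cases x with
  | inl x₀ => rfl
  | inr x₁ =>
      show D (fun x₀ => ∑ y' : g.Site, w y' * k x₀ y' * B y') x₁ =
        ∑ y' : g.Site, w y' * (D fun x₀ => k x₀ y') x₁ * B y'
      have hfun : (fun x₀ => ∑ y' : g.Site, w y' * k x₀ y' * B y') =
          ∑ y' : g.Site, (w y' * B y') • (fun x₀ => k x₀ y') := by
        funext x₀
        rw [Finset.sum_apply]
        exact Finset.sum_congr rfl fun y' _ => by rw [Pi.smul_apply, smul_eq_mul]; ring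
      rw [hfun, map_sum, Finset.sum_apply]
      exact Finset.sum_congr rfl fun y' _ => by rw [map_smul, Pi.smul_apply, smul_eq_mul]; ring

variable [Fintype X₀] [Fintype X₁]

/-- The jet N-size: the weighted sharp-block size on X₀ ⊕ X₁ with blocks blk₀ ⊔ blk₁ and weights wt₀ ⊔ wt₁ — with
wt₀ = (L^jη)¹, wt₁ = (L^jη)² this is max{|𝔄|_{(−1)}, |∇𝔄|_{(−2)}} localised to the block of y (`loc_jet_eq_max`).
[cite: Balaban1985Variational, (115) p.294 + p.295] -/
noncomputable def jetSize (g : B6.Geometry) (blk₀ : X₀ → g.Site) (blk₁ : X₁ → g.Site) (wt₀ : X₀ → ℝ)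
    (wt₁ : X₁ → ℝ) (h₀ : ∀ x, 0 ≤ wt₀ x) (h₁ : ∀ x, 0 ≤ wt₁ x) : BlockNorm g (X₀ ⊕ X₁ → ℝ) :=
  weightedBlocks g (Sum.elim blk₀ blk₁) (Sum.elim wt₀ wt₁) (by rintro (x | x) <;> simp [h₀, h₁])

/-- **The N-size IS the maximum** of the two weighted sizes of the components: loc_y(F) = max{loc⁰_y(F∘inl),
loc¹_y(F∘inr)} — *"max{|𝔄|_{(−1)}, |∇𝔄|_{(−2)}}"* verbatim once F = jet ∇ 𝔄. [cite: Balaban1985Variational, p.295 + (115) p.294] -/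
theorem loc_jet_eq_max {blk₀ : X₀ → g.Site} {blk₁ : X₁ → g.Site} {wt₀ : X₀ → ℝ} {wt₁ : X₁ → ℝ}
    {h₀ : ∀ x, 0 ≤ wt₀ x} {h₁ : ∀ x, 0 ≤ wt₁ x} (y : g.Site) (F : X₀ ⊕ X₁ → ℝ) :
    (jetSize g blk₀ blk₁ wt₀ wt₁ h₀ h₁).loc y F =
      max ((weightedBlocks g blk₀ wt₀ h₀).loc y (F ∘ Sum.inl)) ((weightedBlocks g blk₁ wt₁ h₁).loc y (F ∘ Sum.inr)) := by
  refine le_antisymm ?_ ?_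
  · refine loc_le (le_max_of_le_left ((weightedBlocks g blk₀ wt₀ h₀).loc_nonneg y _)) ?_
    rintro (x₀ | x₁) hx
    · exact (le_loc (hwt := h₀) (F ∘ Sum.inl) (x := x₀) hx).trans (le_max_left _ _)
    · exact (le_loc (hwt := h₁) (F ∘ Sum.inr) (x := x₁) hx).trans (le_max_right _ _)
  · refine max_le ?_ ?_
    · refine loc_le ((jetSize g blk₀ blk₁ wt₀ wt₁ h₀ h₁).loc_nonneg y F) fun x₀ hx => ?_
      exact le_loc (blk := Sum.elim blk₀ blk₁) (wt := Sum.elim wt₀ wt₁) F (x := Sum.inl x₀) hx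
    · refine loc_le ((jetSize g blk₀ blk₁ wt₀ wt₁ h₀ h₁).loc_nonneg y F) fun x₁ hx => ?_
      exact le_loc (blk := Sum.elim blk₀ blk₁) (wt := Sum.elim wt₀ wt₁) F (x := Sum.inr x₁) hx

/-- **Kernel bounds ⟺ majorant on the jet carrier**: the operator with kernel k̂ on X₀ ⊕ X₁ and pairing weight w,
out of the B-size (weight w_B ≥ 0), has the majorant K ≥ 0 into the jet N-size iff BOTH component kernels obey the
corresponding pointwise bounds — the two lines n = 0, 1 of (190) / of [5] (3.133) read as one majorant.
[cite: Balaban1985Variational, (190) p.308; Balaban1985BackgroundPropagators, (3.133) p.422] -/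
theorem hasMaj_jet_iff (blk₀ : X₀ → g.Site) (blk₁ : X₁ → g.Site) (wt₀ : X₀ → ℝ) (wt₁ : X₁ → ℝ)
    (h₀ : ∀ x, 0 ≤ wt₀ x) (h₁ : ∀ x, 0 ≤ wt₁ x) (wB : g.Site → ℝ) (hwB : ∀ y, 0 ≤ wB y) (w : g.Site → ℝ)
    (hw : ∀ y, 0 ≤ w y) (kk : X₀ ⊕ X₁ → g.Site → ℝ) (K : g.Site → g.Site → ℝ) (hK : ∀ y y', 0 ≤ K y y') :
    HasMaj (weightedBlocks g id wB hwB) (jetSize g blk₀ blk₁ wt₀ wt₁ h₀ h₁) (kernelOp w kk) K ↔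
      (∀ (x₀ : X₀) (y' : g.Site), wt₀ x₀ * (w y' * |kk (Sum.inl x₀) y'|) ≤ K (blk₀ x₀) y' * wB y') ∧
      (∀ (x₁ : X₁) (y' : g.Site), wt₁ x₁ * (w y' * |kk (Sum.inr x₁) y'|) ≤ K (blk₁ x₁) y' * wB y') := by
  unfold jetSize
  rw [hasMaj_kernelOp_iff (Sum.elim blk₀ blk₁) _ _ wB hwB w hw kk K hK]
  constructor
  · intro h; exact ⟨fun x₀ y' => h (Sum.inl x₀) y', fun x₁ y' => h (Sum.inr x₁) y'⟩
  · rintro ⟨hl, hr⟩ (x₀ | x₁) y'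
    · exact hl x₀ y'
    · exact hr x₁ y'

end Jet

/-! ## §6. Lifting the equations of Sect. G to the jet carrier -/

section Lift

variable {FB FA F3 FJ : Type} [AddCommGroup FB] [Module ℝ FB] [AddCommGroup FA] [Module ℝ FA]
  [AddCommGroup F3] [Module ℝ F3] [AddCommGroup FJ] [Module ℝ FJ]

/-- (184) lifts along the jet: if the kernel W = ((δ²/δA′²)V)(𝒜₀ + H₀B) factors through the jet, W = W̃ ∘ J (it
depends on 𝔄 through (𝔄, ∇𝔄) — the printed size of its argument is max{|𝔄|_{(−1)}, |∇𝔄|_{(−2)}}, (186), (189)),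
then J𝔄₀, JH₀, JG̃ satisfy (184) with W̃.  HONEST NOTE: the hypothesis `Ineq189 bN b3 W̃ θ δ₀` on the jet carrier
then quantifies over ALL localised jets, not only the holonomic ones (f₁ = ∇f₀) — a typed STRENGTHENING of the
printed sentence (189) (cell DIVERGENCE D-B11-15). [cite: Balaban1985Variational, (184) p.307 + (186), (189) p.308] -/
theorem eq184_lift (J : FA →ₗ[ℝ] FJ) {A0 H0 : FB →ₗ[ℝ] FA} {Gt : F3 →ₗ[ℝ] FA} {W : FA →ₗ[ℝ] F3}
    {Wt : FJ →ₗ[ℝ] F3} {D2H0 : FB →ₗ[ℝ] F3} (hW : W = Wt ∘ₗ J) (h : Eq184 A0 H0 Gt W D2H0) :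
    Eq184 (J ∘ₗ A0) (J ∘ₗ H0) (J ∘ₗ Gt) Wt D2H0 := by
  unfold Eq184 at h ⊢
  subst hW
  apply LinearMap.ext
  intro μ
  have hμ := LinearMap.congr_fun h μ
  simp only [LinearMap.add_apply, LinearMap.sub_apply, LinearMap.comp_apply] at hμ ⊢
  rw [← map_add, hμ, map_sub]

/-- (182) lifts along the jet: if 𝔇(𝒜₀ + H₀B) = (δ/δA′)D factors through the jet, 𝔇 = 𝔇̃ ∘ J, then Jδ𝓗, J𝔄₀, JH₀,
JH satisfy (182) with 𝔇̃. [cite: Balaban1985Variational, (182) p.307] -/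
theorem eq182_lift (J : FA →ₗ[ℝ] FJ) {dH A0 H0 H : FB →ₗ[ℝ] FA} {Dfr : FA →ₗ[ℝ] FB} {Dfrt : FJ →ₗ[ℝ] FB}
    (hD : Dfr = Dfrt ∘ₗ J) (h : Eq182 dH A0 H0 H Dfr) :
    Eq182 (J ∘ₗ dH) (J ∘ₗ A0) (J ∘ₗ H0) (J ∘ₗ H) Dfrt := by
  unfold Eq182 at h ⊢
  subst hD
  subst h
  apply LinearMap.ext
  intro μ
  simp only [LinearMap.add_apply, LinearMap.sub_apply, LinearMap.comp_apply, map_add, map_sub]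

/-- A majorant OUT OF the jet size is inherited from a majorant out of the first component when the operator only
reads the first component — not needed by the chain (all Sect. G hypotheses are stated on the jet directly) but
recording that nothing is lost: (188)'s a-priori bound for J𝔄₀ is `Bound188 bB (jetSize …) (J ∘ₗ A0) M₀` verbatim.
[cite: Balaban1985Variational, (188) p.308] -/
theorem bound188_jet_iff {X₀ X₁ : Type} [Fintype X₀] [Fintype X₁] {bB : BlockNorm g FB} {blk₀ : X₀ → g.Site}
    {blk₁ : X₁ → g.Site} {wt₀ : X₀ → ℝ} {wt₁ : X₁ → ℝ} {h₀ : ∀ x, 0 ≤ wt₀ x} {h₁ : ∀ x, 0 ≤ wt₁ x}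
    (T : FB →ₗ[ℝ] (X₀ ⊕ X₁ → ℝ)) (M₀ : ℝ) :
    Bound188 bB (jetSize g blk₀ blk₁ wt₀ wt₁ h₀ h₁) T M₀ ↔
      ∀ (y' : g.Site) (μ : FB), bB.IsLoc y' μ → ∀ y : g.Site,
        max ((weightedBlocks g blk₀ wt₀ h₀).loc y (T μ ∘ Sum.inl))
            ((weightedBlocks g blk₁ wt₁ h₁).loc y (T μ ∘ Sum.inr)) ≤ M₀ * bB.loc y' μ := by
  unfold Bound188 HasMaj
  simp only [loc_jet_eq_max]

end Lift

/-! ## §7. Scale exchange: (L^jη) versus (L^{j′}η) under the level gap of (2.60) [3] -/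

/-- The LEVEL GAP: RM(|j − j′| − 1) ≤ d(y, y′) for y ∈ Λ_j, y′ ∈ Λ_{j′} — the geometric content of (2.60) of Lemma 2.1
[3] (*"e^{−αδ₀d(y,y′)} ≤ e^{−αδ₀RM max{|j−j′|−1, 0}}"*, `B6RandomWalk.Ineq260`): points of 𝔅 at levels j, j′ are at
least RM(|j − j′| − 1) apart. [cite: Balaban1984PropagatorsII, Lemma 2.1 (2.60) p.234] -/
def LevelGap (g : B6.Geometry) : Prop :=
  ∀ y y' : g.Site, g.R * g.M * (|(g.scale y : ℝ) - g.scale y'| - 1) ≤ g.dist y y'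

/-- (2.60) at any rate αδ₀ > 0 IS the level gap (RM ≥ 0). [cite: Balaban1984PropagatorsII, (2.60) p.234] -/
theorem levelGap_of_ineq260 {δ₀ α : ℝ} (hαδ : 0 < α * δ₀) (hRM : 0 ≤ g.R * g.M) (h : Ineq260 g δ₀ α) :
    LevelGap g := by
  intro y y'
  have h1 := h y y'
  rw [Real.exp_le_exp] at h1
  have h2 : α * δ₀ * (g.R * g.M * max (|(g.scale y : ℝ) - g.scale y'| - 1) 0) ≤ α * δ₀ * g.dist y y' := by
    have e : α * δ₀ * g.R * g.M * max (|(g.scale y : ℝ) - g.scale y'| - 1) 0 =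
        α * δ₀ * (g.R * g.M * max (|(g.scale y : ℝ) - g.scale y'| - 1) 0) := by ring
    linarith [h1, e]
  have h3 : g.R * g.M * max (|(g.scale y : ℝ) - g.scale y'| - 1) 0 ≤ g.dist y y' :=
    le_of_mul_le_mul_left h2 hαδ
  exact (mul_le_mul_of_nonneg_left (le_max_left _ _) hRM).trans h3

/-- **Scale exchange** (the undisplayed step behind *"(L^jη)^{−1}, or (L^{j′}η)^{−1}"* of [5] p. 422 and behind every
use of (3.133) [5] inside B11 — cell GAPS C-IF-03, G-B8-06, G-B9-12): under the level gap, L ≥ 1 and log L ≤ εRM,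
L^jη ≤ L·e^{εd(y,y′)}·L^{j′}η.  Proof: for j ≤ j′ trivially; for j > j′, L^{j−j′} = L·L^{j−j′−1} ≤ L·e^{εRM(j−j′−1)}
≤ L·e^{εd(y,y′)}.  (Compare `B9SectDL2Decay.len_pow_le_of_ineq260`: the un-mirrored (L^{j′}η)^t ≤ L^t(L^jη)^t e^{αδ₀d(y,y′)}
straight from `Ineq260`; the mirrored form here needs no symmetry of d because the level gap bounds |j − j′|.) [cite: Balaban1984PropagatorsII, Lemma 2.1 (2.60) p.234; Balaban1985BackgroundPropagators, (3.133) p.422] -/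
theorem len_le_exchange (hL : 1 ≤ g.L) (hη : 0 ≤ g.eta) (hd : ∀ a b : g.Site, 0 ≤ g.dist a b)
    (hgap : LevelGap g) {ε : ℝ} (hε : 0 ≤ ε) (hεL : Real.log g.L ≤ ε * (g.R * g.M)) (y y' : g.Site) :
    g.len y ≤ g.L * Real.exp (ε * g.dist y y') * g.len y' := by
  have hL0 : 0 < g.L := lt_of_lt_of_le one_pos hL
  have hexp1 : 1 ≤ Real.exp (ε * g.dist y y') := Real.one_le_exp (mul_nonneg hε (hd y y'))
  have key : g.L ^ g.scale y ≤ g.L * Real.exp (ε * g.dist y y') * g.L ^ g.scale y' := by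
    rcases Nat.lt_or_ge (g.scale y') (g.scale y) with hjj | hjj
    · obtain ⟨m, hm⟩ : ∃ m : ℕ, g.scale y = g.scale y' + (m + 1) := ⟨g.scale y - g.scale y' - 1, by omega⟩
      have hgap' : g.R * g.M * (m : ℝ) ≤ g.dist y y' := by
        have h1 := hgap y y'
        have habs : |(g.scale y : ℝ) - g.scale y'| = m + 1 := by
          rw [hm, Nat.cast_add, Nat.cast_add, Nat.cast_one,
            show ((g.scale y' : ℝ) + ((m : ℝ) + 1)) - g.scale y' = m + 1 by ring]
          exact abs_of_nonneg (by positivity)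
        rw [habs, show ((m : ℝ) + 1 - 1) = m by ring] at h1
        exact h1
      have hLm : g.L ^ m ≤ Real.exp (ε * g.dist y y') := by
        have e1 : g.L ^ m = Real.exp ((m : ℝ) * Real.log g.L) := by rw [Real.exp_nat_mul, Real.exp_log hL0]
        rw [e1, Real.exp_le_exp]
        calc (m : ℝ) * Real.log g.L ≤ m * (ε * (g.R * g.M)) := mul_le_mul_of_nonneg_left hεL (Nat.cast_nonneg m)
          _ = ε * (g.R * g.M * m) := by ring
          _ ≤ ε * g.dist y y' := mul_le_mul_of_nonneg_left hgap' hε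
      calc g.L ^ g.scale y = g.L ^ g.scale y' * g.L * g.L ^ m := by rw [hm, pow_add, pow_succ]; ring
        _ ≤ g.L ^ g.scale y' * g.L * Real.exp (ε * g.dist y y') :=
            mul_le_mul_of_nonneg_left hLm (by positivity)
        _ = g.L * Real.exp (ε * g.dist y y') * g.L ^ g.scale y' := by ring
    · calc g.L ^ g.scale y ≤ g.L ^ g.scale y' := pow_le_pow_right₀ hL hjj
        _ = 1 * 1 * g.L ^ g.scale y' := by ring
        _ ≤ g.L * Real.exp (ε * g.dist y y') * g.L ^ g.scale y' := by
            gcongr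
  calc g.len y = g.L ^ g.scale y * g.eta := rfl
    _ ≤ (g.L * Real.exp (ε * g.dist y y') * g.L ^ g.scale y') * g.eta := mul_le_mul_of_nonneg_right key hη
    _ = g.L * Real.exp (ε * g.dist y y') * g.len y' := by unfold B6.Geometry.len; ring

/-- Scale exchange on a decaying kernel prefactor: (L^jη)(L^{j′}η)^{−1}e^{−ρd(y,y′)} ≤ L·e^{−(ρ−ε)d(y,y′)} — exchanging
(L^{j′}η)^{−1} for (L^jη)^{−1} costs the constant L and the rate ε (any ε ≥ log L/(RM)).
[cite: Balaban1985BackgroundPropagators, (3.133) p.422; Balaban1984PropagatorsII, (2.60) p.234] -/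
theorem prefactor_exchange (hL : 1 ≤ g.L) (hη : 0 < g.eta) (hd : ∀ a b : g.Site, 0 ≤ g.dist a b)
    (hgap : LevelGap g) {ε : ℝ} (hε : 0 ≤ ε) (hεL : Real.log g.L ≤ ε * (g.R * g.M)) (ρ : ℝ) (y y' : g.Site) :
    g.len y * (g.len y')⁻¹ * Real.exp (-(ρ * g.dist y y')) ≤ g.L * Real.exp (-((ρ - ε) * g.dist y y')) := by
  have hL0 : 0 < g.L := lt_of_lt_of_le one_pos hL
  have hpos : 0 < g.len y' := mul_pos (pow_pos hL0 _) hη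
  have h := len_le_exchange hL hη.le hd hgap hε hεL y y'
  calc g.len y * (g.len y')⁻¹ * Real.exp (-(ρ * g.dist y y'))
      ≤ (g.L * Real.exp (ε * g.dist y y') * g.len y') * (g.len y')⁻¹ * Real.exp (-(ρ * g.dist y y')) := by
        gcongr
    _ = g.L * (Real.exp (ε * g.dist y y') * Real.exp (-(ρ * g.dist y y'))) := by
        field_simp
    _ = g.L * Real.exp (-((ρ - ε) * g.dist y y')) := by
        rw [← Real.exp_add]; ring_nf

/-! ## §8. The verbatim instances: (130), (3.133) [5] with (129), and (190) with `B11.pref190` by name -/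

section Instances

/-- L^jη > 0 for L, η > 0. [folklore] -/
theorem len_pos (hL : 0 < g.L) (hη : 0 < g.eta) (y : g.Site) : 0 < g.len y := mul_pos (pow_pos hL _) hη

/-- The η-scale volume weight (L^{j′}η)^d of a site y′ ∈ Λ_{j′} (the pairing weight producing the factor (L^{j′}η)^{−d}
of (130), (190), [5] (3.133)). [cite: Balaban1985Variational, (130) p.298] -/
noncomputable def vol (g : B6.Geometry) (d : ℕ) : g.Site → ℝ := fun y' => g.len y' ^ d

/-- The B-size |B| = sup_{y′∈𝔅}|B(y′)| of (130), (170): singleton blocks, weight 1. [cite: Balaban1985Variational, (130) p.298] -/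
noncomputable def supB (g : B6.Geometry) : BlockNorm g (g.Site → ℝ) :=
  weightedBlocks g id (fun _ => (1 : ℝ)) fun _ => zero_le_one

/-- The localised |·|_{(−n)}: weight (L^jη)ⁿ at x ∈ Δ(y), y ∈ Λ_j. [cite: Balaban1985Variational, (115) p.294 + (130) p.298] -/
noncomputable def negSize (g : B6.Geometry) {X : Type} [Fintype X] (blk : X → g.Site) (n : ℕ) (hL : 0 ≤ g.L)
    (hη : 0 ≤ g.eta) : BlockNorm g (X → ℝ) :=
  weightedBlocks g blk (fun x => g.len (blk x) ^ n) fun _ => pow_nonneg (mul_nonneg (pow_nonneg hL _) hη) n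

/-- The jet N-size with weights (L^jη)^{n₀} on X₀ and (L^jη)^{n₁} on X₁; (n₀, n₁) = (1, 2) is max{|·|_{(−1)},
|∇·|_{(−2)}} (p. 295), (0, 1) is the size of the entries [1, (L^jη)^{−1}] of [5] (3.133).
[cite: Balaban1985Variational, p.295; Balaban1985BackgroundPropagators, (3.133) p.422] -/
noncomputable def jetNegSize (g : B6.Geometry) {X₀ X₁ : Type} [Fintype X₀] [Fintype X₁] (blk₀ : X₀ → g.Site)
    (blk₁ : X₁ → g.Site) (n₀ n₁ : ℕ) (hL : 0 ≤ g.L) (hη : 0 ≤ g.eta) : BlockNorm g (X₀ ⊕ X₁ → ℝ) :=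
  jetSize g blk₀ blk₁ (fun x => g.len (blk₀ x) ^ n₀) (fun x => g.len (blk₁ x) ^ n₁)
    (fun _ => pow_nonneg (mul_nonneg (pow_nonneg hL _) hη) n₀)
    (fun _ => pow_nonneg (mul_nonneg (pow_nonneg hL _) hη) n₁)

/-- The pointwise dictionary behind (115)/(130)/(190)/(3.133): for t, s > 0,
tⁿ·(s^d·a) ≤ C·E·1 ⟺ a ≤ C·t^{−n}·s^{−d}·E. [folklore] -/
theorem pointwise_dictionary {t s a C E : ℝ} (ht : 0 < t) (hs : 0 < s) (n d : ℕ) :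
    t ^ n * (s ^ d * a) ≤ C * E * 1 ↔ a ≤ C * t ^ (-(n : ℝ)) * s ^ (-(d : ℝ)) * E := by
  rw [Real.rpow_neg ht.le, Real.rpow_neg hs.le, Real.rpow_natCast, Real.rpow_natCast, mul_one]
  have htn : 0 < t ^ n := pow_pos ht n
  have hsd : 0 < s ^ d := pow_pos hs d
  rw [show C * (t ^ n)⁻¹ * (s ^ d)⁻¹ * E = C * E / (t ^ n * s ^ d) by
      rw [div_eq_mul_inv, mul_inv]; ring]
  rw [le_div_iff₀ (mul_pos htn hsd), show t ^ n * (s ^ d * a) = a * (t ^ n * s ^ d) by ring]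

/-- **(130), kernel form ⟺ majorant form**, kernel-checked over the concrete carriers: for a kernel k on X × 𝔅 with
the η-scale pairing, *"|(Δ_{U₀}H_{0,μν})(x, y′)| ≦ B₀(L^jη)^{−3}(L^{j′}η)^{−d}e^{−δ₀d(y,y′)}, x ∈ Δ(y), y ∈ Λ_j,
y′ ∈ Λ_{j′}"* (n = 3, C = B₀, ρ = δ₀) says exactly that the operator has the majorant B₀e^{−δ₀d(y,y′)} from the B-size
|B| into the localised |·|_{(−3)}; the same with n = 1, 2 and ρ = ⅛δ₀ are the lines n = 0, 1 of (190), and with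
n = 0, 1, ρ = ½δ₁ the first two entries of [5] (3.133).  Combined with `opBound_of_hasMaj` this is the printed
*"… or |Δ_{U₀}H₀B|_{(−3)} ≦ B₀|B|"*. [cite: Balaban1985Variational, (130) p.298 + (190) p.308; Balaban1985BackgroundPropagators, (3.133) p.422] -/
theorem hasMaj_negSize_iff_kernelBound {X : Type} [Fintype X] (blk : X → g.Site) (n d : ℕ) (hL : 0 < g.L)
    (hη : 0 < g.eta) (k : X → g.Site → ℝ) {C ρ : ℝ} (hC : 0 ≤ C) :
    HasMaj (supB g) (negSize g blk n hL.le hη.le) (kernelOp (vol g d) k)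
        (fun y y' => C * Real.exp (-(ρ * g.dist y y'))) ↔
      ∀ (x : X) (y' : g.Site), |k x y'| ≤ C * g.len (blk x) ^ (-(n : ℝ)) * g.len y' ^ (-(d : ℝ)) *
        Real.exp (-(ρ * g.dist (blk x) y')) := by
  unfold supB negSize
  rw [hasMaj_kernelOp_iff blk _ _ (fun _ => (1 : ℝ)) (fun _ => zero_le_one) (vol g d)
    (fun y => pow_nonneg (len_pos hL hη y).le d) k _ (fun y y' => mul_nonneg hC (Real.exp_nonneg _))]
  refine forall_congr' fun x => forall_congr' fun y' => ?_
  exact pointwise_dictionary (len_pos hL hη (blk x)) (len_pos hL hη y') n d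

/-- **(130) verbatim ⟹ the operator bound**: the printed kernel bound gives |Δ_{U₀}H₀B|_{(−3)} ≦ B₀·c·|B| block by
block (c = the row-sum constant of (2.61) at the rate δ₀; the paper's right-hand "B₀" absorbs c).
[cite: Balaban1985Variational, (130) p.298; Balaban1984PropagatorsII, (2.61) p.234] -/
theorem ineq130_opBound {X : Type} [Fintype X] (blk : X → g.Site) (d : ℕ) (hL : 0 < g.L) (hη : 0 < g.eta)
    (k : X → g.Site → ℝ) {B₀ δ₀ c : ℝ} (hB₀ : 0 ≤ B₀) (hrow : RowSum g δ₀ c)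
    (h130 : ∀ (x : X) (y' : g.Site), |k x y'| ≤ B₀ * g.len (blk x) ^ (-(3 : ℝ)) * g.len y' ^ (-(d : ℝ)) *
      Real.exp (-(δ₀ * g.dist (blk x) y')))
    (B : g.Site → ℝ) (y : g.Site) :
    (negSize g blk 3 hL.le hη.le).loc y (kernelOp (vol g d) k B) ≤ B₀ * c * fsup (fun y' => |B y'|) := by
  have h : HasMaj (supB g) (negSize g blk 3 hL.le hη.le) (kernelOp (vol g d) k)
      (fun y y' => B₀ * Real.exp (-(δ₀ * g.dist y y'))) := by
    rw [hasMaj_negSize_iff_kernelBound blk 3 d hL hη k hB₀]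
    simpa using h130
  simpa only [one_mul] using opBound_of_hasMaj (hwB := fun _ => zero_le_one) _ _ hB₀ h hrow B y

/-- `B11.pref190` entry n = 0 is (L^jη)^{−1}. [cite: Balaban1985Variational, (190) p.308] -/
theorem pref190_zero (t β : ℝ) : B11.pref190 t β 0 = t ^ (-(1 : ℝ)) := by
  simp [B11.pref190]

/-- `B11.pref190` entry n = 1 is (L^jη)^{−2}. [cite: Balaban1985Variational, (190) p.308] -/
theorem pref190_one (t β : ℝ) : B11.pref190 t β 1 = t ^ (-(2 : ℝ)) := by
  simp [B11.pref190]

/-- **(190), entries n = 0, 1, with `B11.pref190` BY NAME ⟺ `B11SectG.Ineq190` on the jet carrier** — the claim of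
the `B11SectG` header (*"with `bout` = the N-size this is the pair of entries n = 0, 1 of `B11.pref190` (scale weights
and (L^{j′}η)^{−d} inside the sizes)"*) KERNEL-CHECKED: for the operator δ𝓗 read through its jet kernel k̂ (columns
(δ/δB_ν(y′))𝓗_μ(B, x) on X₀ and ∇_x(δ/δB_ν(y′))𝓗_μ(B, x) on X₁) with the η-scale pairing, `Ineq190 (supB g)
(jetNegSize g blk₀ blk₁ 1 2) δ𝓗 C δ₀` is literally the pair of printed lines *"|(δ/δB_ν(y′))𝓗_μ(B,x)|,
|∇_x(δ/δB_ν(y′))𝓗_μ(B,x)| ≤ C[(L^jη)^{−1}, (L^jη)^{−2}](L^{j′}η)^{−d}exp(−⅛δ₀d(y,y′)) for x ∈ Δ(y), y ∈ Λ_j,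
y′ ∈ Λ_{j′}"* (O(1) = C; β is idle in these two entries). [cite: Balaban1985Variational, (190) p.308] -/
theorem ineq190_jet_iff_pref190 {X₀ X₁ : Type} [Fintype X₀] [Fintype X₁] (blk₀ : X₀ → g.Site) (blk₁ : X₁ → g.Site)
    (d : ℕ) (β : ℝ) (hL : 0 < g.L) (hη : 0 < g.eta) (kk : X₀ ⊕ X₁ → g.Site → ℝ) {C δ₀ : ℝ} (hC : 0 ≤ C) :
    Ineq190 (supB g) (jetNegSize g blk₀ blk₁ 1 2 hL.le hη.le) (kernelOp (vol g d) kk) C δ₀ ↔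
      (∀ (x₀ : X₀) (y' : g.Site), |kk (Sum.inl x₀) y'| ≤ C * B11.pref190 (g.len (blk₀ x₀)) β 0 *
          g.len y' ^ (-(d : ℝ)) * Real.exp (-(δ₀ / 8 * g.dist (blk₀ x₀) y'))) ∧
      (∀ (x₁ : X₁) (y' : g.Site), |kk (Sum.inr x₁) y'| ≤ C * B11.pref190 (g.len (blk₁ x₁)) β 1 *
          g.len y' ^ (-(d : ℝ)) * Real.exp (-(δ₀ / 8 * g.dist (blk₁ x₁) y'))) := by
  unfold Ineq190 supB jetNegSize
  rw [hasMaj_jet_iff blk₀ blk₁ _ _ _ _ (fun _ => (1 : ℝ)) (fun _ => zero_le_one) (vol g d)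
    (fun y => pow_nonneg (len_pos hL hη y).le d) kk _ (fun y y' => mul_nonneg hC (Real.exp_nonneg _))]
  refine and_congr (forall_congr' fun x₀ => forall_congr' fun y' => ?_)
    (forall_congr' fun x₁ => forall_congr' fun y' => ?_)
  · rw [pref190_zero, show (-(1 : ℝ)) = -((1 : ℕ) : ℝ) by norm_num]
    exact pointwise_dictionary (len_pos hL hη (blk₀ x₀)) (len_pos hL hη y') 1 d
  · rw [pref190_one, show (-(2 : ℝ)) = -((2 : ℕ) : ℝ) by norm_num]
    exact pointwise_dictionary (len_pos hL hη (blk₁ x₁)) (len_pos hL hη y') 2 d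

/-- **(129) + [5] (3.133) ⟹ the `hH0` / `hH`-shaped hypothesis of `B11SectG.ineq190_of_189`**, kernel-checked with
the undisplayed scale exchange (cell GAPS C-IF-03): if the (3.126)-operator H of [5], read through its jet kernel
(k, ∇k) with the η-scale pairing, obeys the first two entries of (3.133) — *"|H_{μν}(x, y′)|, |∇H_{μν}(x, y′)| ≤
C[1, (L^jη)^{−1}](L^{j′}η)^{−d}e^{−ρd(y,y′)}"* (ρ = ½δ₁ there) — then B11's H₀ = H ∘ (L^{j(·)}η)^{−1} of (129) has the
majorant C·L·e^{−(ρ−ε)d(y,y′)} from the B-size |B| into the N-size max{|·|_{(−1)}, |∇·|_{(−2)}}, for every ε ≥ log L/(RM)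
(level gap of (2.60) [3], L ≥ 1): the constant A₀ of `hH0` is C·L and its rate is ρ − ε.  The *"(L^{j′}η)^{−1}"*
produced by (129) is exchanged for the (L^jη)^{−1} the N-size wants (`prefactor_exchange`).
[cite: Balaban1985Variational, (129) p.297; Balaban1985BackgroundPropagators, (3.133) p.422; Balaban1984PropagatorsII, (2.60) p.234] -/
theorem hH0Shape_of_kernelBounds {X₀ X₁ : Type} [Fintype X₀] [Fintype X₁] (blk₀ : X₀ → g.Site)
    (blk₁ : X₁ → g.Site) (D : (X₀ → ℝ) →ₗ[ℝ] (X₁ → ℝ)) (d : ℕ) (hL : 1 ≤ g.L) (hη : 0 < g.eta)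
    (hd : ∀ a b : g.Site, 0 ≤ g.dist a b) (hgap : LevelGap g) {ε : ℝ} (hε : 0 ≤ ε)
    (hεL : Real.log g.L ≤ ε * (g.R * g.M)) (k : X₀ → g.Site → ℝ) {C ρ : ℝ} (hC : 0 ≤ C)
    (hk₀ : ∀ (x₀ : X₀) (y' : g.Site), |k x₀ y'| ≤ C * g.len y' ^ (-(d : ℝ)) * Real.exp (-(ρ * g.dist (blk₀ x₀) y')))
    (hk₁ : ∀ (x₁ : X₁) (y' : g.Site), |D (fun x₀ => k x₀ y') x₁| ≤
      C * (g.len (blk₁ x₁))⁻¹ * g.len y' ^ (-(d : ℝ)) * Real.exp (-(ρ * g.dist (blk₁ x₁) y'))) :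
    HasMaj (supB g) (jetNegSize g blk₀ blk₁ 1 2 (zero_le_one.trans hL) hη.le)
      ((jet D ∘ₗ kernelOp (vol g d) k) ∘ₗ scaleInv g)
      (fun y y' => C * g.L * Real.exp (-((ρ - ε) * g.dist y y'))) := by
  have hL0 : 0 < g.L := lt_of_lt_of_le one_pos hL
  -- (i) the (3.133)-entries [1, (L^jη)^{−1}] = the majorant C e^{−ρd} into the jet size with weights (0, 1)
  have h01 : HasMaj (supB g) (jetNegSize g blk₀ blk₁ 0 1 hL0.le hη.le) (jet D ∘ₗ kernelOp (vol g d) k)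
      (fun y y' => C * Real.exp (-(ρ * g.dist y y'))) := by
    rw [jet_comp_kernelOp]
    unfold supB jetNegSize
    rw [hasMaj_jet_iff blk₀ blk₁ _ _ _ _ (fun _ => (1 : ℝ)) (fun _ => zero_le_one) (vol g d)
      (fun y => pow_nonneg (len_pos hL0 hη y).le d) _ _ (fun y y' => mul_nonneg hC (Real.exp_nonneg _))]
    constructor
    · intro x₀ y'
      rw [jetKernel_inl]
      refine (pointwise_dictionary (len_pos hL0 hη (blk₀ x₀)) (len_pos hL0 hη y') 0 d).mpr ?_
      simpa using hk₀ x₀ y'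
    · intro x₁ y'
      rw [jetKernel_inr]
      refine (pointwise_dictionary (len_pos hL0 hη (blk₁ x₁)) (len_pos hL0 hη y') 1 d).mpr ?_
      have e : g.len (blk₁ x₁) ^ (-((1 : ℕ) : ℝ)) = (g.len (blk₁ x₁))⁻¹ := by
        rw [Nat.cast_one, Real.rpow_neg_one]
      rw [e]
      exact hk₁ x₁ y'
  -- (ii) compose with the scaling (L^{j(·)}η)^{−1} of (129)
  have h01' := HasMaj.comp_scaleInv (fun y => (len_pos hL0 hη y).le) h01
  -- (iii) move one factor L^jη from the kernel into the size: weights (0,1) ↦ (1,2)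
  have h12 : HasMaj (supB g) (jetNegSize g blk₀ blk₁ 1 2 (zero_le_one.trans hL) hη.le)
      ((jet D ∘ₗ kernelOp (vol g d) k) ∘ₗ scaleInv g)
      (fun y y' => g.len y * (C * Real.exp (-(ρ * g.dist y y')) * (g.len y')⁻¹)) := by
    unfold jetNegSize jetSize at h01' ⊢
    refine HasMaj.reweight (blk := Sum.elim blk₀ blk₁) (fun y => g.len y) (fun y => (len_pos hL0 hη y).le) ?_ h01'
    rintro (x₀ | x₁) <;> simp [pow_succ]
  -- (iv) scale exchange
  refine h12.mono fun y y' => ?_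
  have hx := prefactor_exchange hL hη hd hgap hε hεL ρ y y'
  calc g.len y * (C * Real.exp (-(ρ * g.dist y y')) * (g.len y')⁻¹)
      = C * (g.len y * (g.len y')⁻¹ * Real.exp (-(ρ * g.dist y y'))) := by ring
    _ ≤ C * (g.L * Real.exp (-((ρ - ε) * g.dist y y'))) := mul_le_mul_of_nonneg_left hx hC
    _ = C * g.L * Real.exp (-((ρ - ε) * g.dist y y')) := by ring

/-- **(46) from the kernel bounds** (p. 285 [PDF 9], verbatim: *"and the Theorem 3.12 from [5] implies |HB| ≦ B₀(L^jη)^{−1}|B|,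
|∇HB| ≦ B₀(L^jη)^{−2}|B| on Ω_j. (46)"*) — the summation C-IF-03 describes as *"≤ 5 lines, not displayed"*,
KERNEL-CHECKED: under the hypotheses of `hH0Shape_of_kernelBounds` and the row sum (2.61) at the rate ρ − ε with
constant c, the scaled operator B ↦ HB := (operator with kernel k, η-pairing)((L^{j(·)}η)^{−1}B) satisfies, block by
block, (L^jη)·|HB(x)| ≤ C·L·c·sup|B| for x ∈ Δ(y) and (L^jη)²·|∇HB(x₁)| ≤ C·L·c·sup|B| for x₁ ∈ Δ(y) — (46) with
B₀ := C·L·c(ρ − ε). [cite: Balaban1985Variational, (46) p.285; Balaban1985BackgroundPropagators, (3.133) p.422; Balaban1984PropagatorsII, (2.61) p.234] -/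
theorem ineq46_of_kernelBounds {X₀ X₁ : Type} [Fintype X₀] [Fintype X₁] (blk₀ : X₀ → g.Site)
    (blk₁ : X₁ → g.Site) (D : (X₀ → ℝ) →ₗ[ℝ] (X₁ → ℝ)) (d : ℕ) (hL : 1 ≤ g.L) (hη : 0 < g.eta)
    (hd : ∀ a b : g.Site, 0 ≤ g.dist a b) (hgap : LevelGap g) {ε : ℝ} (hε : 0 ≤ ε)
    (hεL : Real.log g.L ≤ ε * (g.R * g.M)) (k : X₀ → g.Site → ℝ) {C ρ c : ℝ} (hC : 0 ≤ C)
    (hk₀ : ∀ (x₀ : X₀) (y' : g.Site), |k x₀ y'| ≤ C * g.len y' ^ (-(d : ℝ)) * Real.exp (-(ρ * g.dist (blk₀ x₀) y')))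
    (hk₁ : ∀ (x₁ : X₁) (y' : g.Site), |D (fun x₀ => k x₀ y') x₁| ≤
      C * (g.len (blk₁ x₁))⁻¹ * g.len y' ^ (-(d : ℝ)) * Real.exp (-(ρ * g.dist (blk₁ x₁) y')))
    (hrow : RowSum g (ρ - ε) c) (B : g.Site → ℝ) (y : g.Site) :
    (negSize g blk₀ 1 (zero_le_one.trans hL) hη.le).loc y (kernelOp (vol g d) k (scaleInv g B)) ≤
        C * g.L * c * fsup (fun y' => |B y'|) ∧
      (negSize g blk₁ 2 (zero_le_one.trans hL) hη.le).loc y (D (kernelOp (vol g d) k (scaleInv g B))) ≤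
        C * g.L * c * fsup (fun y' => |B y'|) := by
  have hL0 : 0 < g.L := lt_of_lt_of_le one_pos hL
  have hmaj := hH0Shape_of_kernelBounds blk₀ blk₁ D d hL hη hd hgap hε hεL k hC hk₀ hk₁
  have hop := opBound_of_hasMaj (hwB := fun _ => zero_le_one) _ _ (mul_nonneg hC hL0.le) hmaj hrow B y
  have e : ((jet D ∘ₗ kernelOp (vol g d) k) ∘ₗ scaleInv g) B =
      Sum.elim (kernelOp (vol g d) k (scaleInv g B)) (D (kernelOp (vol g d) k (scaleInv g B))) := rfl
  rw [e] at hop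
  unfold jetNegSize at hop
  rw [loc_jet_eq_max, Sum.elim_comp_inl, Sum.elim_comp_inr, max_le_iff] at hop
  unfold negSize
  simpa only [one_mul] using hop

end Instances

/-! ## §9. The edge to [5] BY NAME: `B9.Ineq3133` through the transport `B9Thm34Ext.toB6` -/

section B9Edge

open B9Thm34Ext

/-- **[5] (3.133) by name ⟹ the jet majorant**, over the transported geometry `toB6 g₉ R H` (identity on 𝔅, j, d, L, η):
if a B9 `HKernel`'s schematic entries e 0, e 1 (*"sup_{x∈Δ(y)}|H_{μν}(x, y′)|, sup_{x∈Δ(y)}|∇H_{μν}(x, y′)|"*)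
DOMINATE a concrete kernel k and its covariant derivative ∇k block by block (the realisation hypotheses `hreal₀`,
`hreal₁` — `B9.HKernel` carries reals, not operators), then `B9.Ineq3133 d Hk C Cβ δ₁ U` gives the operator with jet
kernel (k, ∇k) and η-scale pairing the majorant C·e^{−½δ₁d(y,y′)} from |B| into the jet size with weights
[1, L^jη] — the two sup-entries of (3.133) as ONE `HasMaj`.  (The Hölder entry and Cβ are not used.)
[cite: Balaban1985BackgroundPropagators, (3.133) p.422] -/
theorem hasMaj_of_B9_ineq3133 (g₉ : B9.Geometry) [Fintype g₉.Site] (R : ℝ) (H : Prop) {Bk : B9.Backgrounds}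
    (Hk : B9.HKernel g₉ Bk) {d : ℕ} {C : ℝ} {Cβ : ℝ → ℝ} {δ₁ : ℝ} {U : Bk.Cfg}
    (h3133 : B9.Ineq3133 d Hk C Cβ δ₁ U) (hC : 0 ≤ C) (hL : 0 < g₉.L) (hη : 0 < g₉.eta)
    {X₀ X₁ : Type} [Fintype X₀] [Fintype X₁] (blk₀ : X₀ → g₉.Site) (blk₁ : X₁ → g₉.Site)
    (D : (X₀ → ℝ) →ₗ[ℝ] (X₁ → ℝ)) (k : X₀ → g₉.Site → ℝ)
    (hreal₀ : ∀ (x₀ : X₀) (y' : g₉.Site), |k x₀ y'| ≤ Hk.e 0 U (blk₀ x₀) y')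
    (hreal₁ : ∀ (x₁ : X₁) (y' : g₉.Site), |D (fun x₀ => k x₀ y') x₁| ≤ Hk.e 1 U (blk₁ x₁) y') :
    HasMaj (supB (toB6 g₉ R H)) (jetNegSize (toB6 g₉ R H) blk₀ blk₁ 0 1 hL.le hη.le)
      (jet D ∘ₗ kernelOp (vol (toB6 g₉ R H) d) k)
      (fun y y' => C * Real.exp (-(δ₁ / 2 * g₉.dist y y'))) := by
  have hlen : ∀ y : g₉.Site, (toB6 g₉ R H).len y = g₉.len y := fun y => rfl
  have hL' : 0 < (toB6 g₉ R H).L := hL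
  have hη' : 0 < (toB6 g₉ R H).eta := hη
  rw [jet_comp_kernelOp]
  unfold supB jetNegSize
  rw [hasMaj_jet_iff blk₀ blk₁ _ _ _ _ (fun _ => (1 : ℝ)) (fun _ => zero_le_one) (vol (toB6 g₉ R H) d)
    (fun y => pow_nonneg (len_pos hL' hη' y).le d) _ _ (fun y y' => mul_nonneg hC (Real.exp_nonneg _))]
  obtain ⟨he, -⟩ := h3133
  constructor
  · intro x₀ y'
    rw [jetKernel_inl]
    refine (pointwise_dictionary (len_pos hL' hη' (blk₀ x₀)) (len_pos hL' hη' y') 0 d).mpr ?_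
    rw [hlen, hlen]
    have h0 := (hreal₀ x₀ y').trans (he 0 (blk₀ x₀) y')
    simp only [Fin.val_zero, CharP.cast_eq_zero, neg_zero, Real.rpow_zero, mul_one] at h0 ⊢
    exact h0
  · intro x₁ y'
    rw [jetKernel_inr]
    refine (pointwise_dictionary (len_pos hL' hη' (blk₁ x₁)) (len_pos hL' hη' y') 1 d).mpr ?_
    rw [hlen, hlen]
    have h1 := (hreal₁ x₁ y').trans (he 1 (blk₁ x₁) y')
    simp only [Fin.val_one, Nat.cast_one, Real.rpow_neg_one] at h1 ⊢
    exact h1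

/-- **[5] (3.133) by name + (129) ⟹ `hH0`-shape for B11's H₀** over `toB6 g₉ R H`: majorant C·L·e^{−(½δ₁−ε)d(y,y′)}
from |B| into max{|·|_{(−1)}, |∇·|_{(−2)}} — `hasMaj_of_B9_ineq3133` followed by the (129) scaling, the re-weighting
and the scale exchange (level gap, L ≥ 1, ε ≥ log L/(RM)).  This is the cross-paper edge C-IF-03 of the cell's
GAPS ledger as a kernel-checked implication; the identification of B11's Sect. G rate "δ₀" in `hH0` with ½δ₁ − ε
(δ₁ of [5] (3.132)) is recorded as DIVERGENCE D-B11-16 (the paper uses one letter δ₀ for all rates).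
[cite: Balaban1985Variational, (129) p.297; Balaban1985BackgroundPropagators, (3.133) p.422; Balaban1984PropagatorsII, (2.60) p.234] -/
theorem hH0Shape_of_B9_ineq3133 (g₉ : B9.Geometry) [Fintype g₉.Site] (R : ℝ) (H : Prop) {Bk : B9.Backgrounds}
    (Hk : B9.HKernel g₉ Bk) {d : ℕ} {C : ℝ} {Cβ : ℝ → ℝ} {δ₁ : ℝ} {U : Bk.Cfg}
    (h3133 : B9.Ineq3133 d Hk C Cβ δ₁ U) (hC : 0 ≤ C) (hL : 1 ≤ g₉.L) (hη : 0 < g₉.eta)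
    (hd : ∀ a b : g₉.Site, 0 ≤ g₉.dist a b) (hgap : LevelGap (toB6 g₉ R H)) {ε : ℝ} (hε : 0 ≤ ε)
    (hεL : Real.log g₉.L ≤ ε * (R * g₉.M))
    {X₀ X₁ : Type} [Fintype X₀] [Fintype X₁] (blk₀ : X₀ → g₉.Site) (blk₁ : X₁ → g₉.Site)
    (D : (X₀ → ℝ) →ₗ[ℝ] (X₁ → ℝ)) (k : X₀ → g₉.Site → ℝ)
    (hreal₀ : ∀ (x₀ : X₀) (y' : g₉.Site), |k x₀ y'| ≤ Hk.e 0 U (blk₀ x₀) y')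
    (hreal₁ : ∀ (x₁ : X₁) (y' : g₉.Site), |D (fun x₀ => k x₀ y') x₁| ≤ Hk.e 1 U (blk₁ x₁) y') :
    HasMaj (supB (toB6 g₉ R H)) (jetNegSize (toB6 g₉ R H) blk₀ blk₁ 1 2 (zero_le_one.trans hL) hη.le)
      ((jet D ∘ₗ kernelOp (vol (toB6 g₉ R H) d) k) ∘ₗ scaleInv (toB6 g₉ R H))
      (fun y y' => C * g₉.L * Real.exp (-((δ₁ / 2 - ε) * g₉.dist y y'))) := by
  have hL0 : 0 < g₉.L := lt_of_lt_of_le one_pos hL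
  obtain ⟨he, -⟩ := h3133
  refine hH0Shape_of_kernelBounds (g := toB6 g₉ R H) blk₀ blk₁ D d hL hη hd hgap hε hεL k hC ?_ ?_
  · intro x₀ y'
    have h0 := (hreal₀ x₀ y').trans (he 0 (blk₀ x₀) y')
    simp only [Fin.val_zero, CharP.cast_eq_zero, neg_zero, Real.rpow_zero, mul_one] at h0
    exact h0
  · intro x₁ y'
    have h1 := (hreal₁ x₁ y').trans (he 1 (blk₁ x₁) y')
    simp only [Fin.val_one, Nat.cast_one, Real.rpow_neg_one] at h1
    exact h1

end B9Edge

end Literature.MathematicalPhysics.QuantumFieldTheory.Balaban1983to89.B11KernelDictionary
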